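import Summits.Langlands.Langlands.Theorems.PicardMuOrdinaryMuOrdinaryFamilyRTCharZeroDefs
import Summits.Langlands.Langlands.Theorems.PicardMuOrdinaryMuOrdinaryFamilyRTPointRoots
import Summits.Langlands.Langlands.Theorems.PicardMuOrdinaryMuOrdinaryFamilyRTThorneRbarAdequate
import Literature.NumberTheory.GaloisRepresentations.HeartOfFourPointsAdequate
import HarnessLib

/-!
# Crux `MuOrdinaryFamilyRT` (stmt-Langlands-13757), line `thorne-minimal-lift`:
# the image of the residual heart is extended-adequate, UNCONDITIONALLY (helper `rbarExtendedAdequate`)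

Registered helper of `stub_finiteOverWeights` (its input `RbarExtendedAdequate` of `…ThorneDebts`),
now proved WITHOUT the Guralnick–Herzig–Tiep named fact `ght2017_adequate_or_index_p_or_psl29`
(JEMS 19 (2017) Thm 1.7, which depends on the classification of finite simple groups and was only
used through its imprimitive case Prop. 6.6).  For a generic quartic `f` whose discriminant lies
neither in `ℚ^{×2}` nor in `−3ℚ^{×2}` and any basis `B` of the heart `(𝔽₃^{Roots f})⁰⁰`, the image
of the framed heart `r̄_f^B : Γ_K → GL₃(𝔽₃)` (`K = ℚ(ζ₃)`) is adequate in the extended sense of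
GHT §1 = Thorne, Math. Z. 285 (2017) Def. 2.20 (`Subgroup.IsExtendedAdequate`), hypothesis (ii) of
Thorne's Thm 5.1.

Proof: the tree's Literature theorem `isExtendedAdequate_range_heartRep_toMatrix`
(`HeartOfFourPointsAdequate.lean`: for `|Ω| = 4`, any `G` acting on `Ω` through ALL of `Sym(Ω)` and
any basis `B` of `Heart 3 Ω`, the range of `Units.map (toMatrixAlgEquiv B) ∘ heartRep 3 Ω G` is
extended-adequate — GHT Prop. 6.6, lines form, CFSG-free) applied to `Ω = Roots f`, `G = Γ_K`:
`rbar f B` is literally this homomorphism (`rfl`), `#Roots f = 4` (`FreeSeedSmoothRt.card_roots`) and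
`Γ_K ↠ Sym(Roots f)` is `range_toPermHom_eq_top` of `…ThorneRbarAdequate` (the discriminant
hypotheses supply an odd permutation, `A₄` is there by genericity).  The conditional form
`rbarExtendedAdequate_of` of `…ThorneRbarAdequate` is thereby superseded.
-/

-- `Summit.Langlands.Langlands.…` (summit = sub-problem name, D-0017 layout) trips `dupNamespace` on every decl.
set_option linter.dupNamespace false

namespace Summit.Langlands.Langlands.Cruxes.MuOrdinaryFamilyRT.ThorneMinimalLift

open scoped Polynomial
open Field
open Literature.NumberTheory.GaloisRepresentations
open Summit.Langlands.Langlands.Cruxes.MuOrdinaryFamilyRT.CharZeroDominance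

noncomputable section

/-- **`Γ_K` acts on the four roots through all of `Sym(Roots f)`** (surjective form of
`range_toPermHom_eq_top`) when `f` is generic with `disc f ∉ ℚ^{×2} ∪ (−3)ℚ^{×2}`. -/
theorem toPermHom_surjective {f : ℤ[X]} (hgen : Generic f)
    (hD : ¬ IsSquare (f.map (Int.castRingHom ℚ)).discr)
    (hD3 : ¬ IsSquare ((-3 : ℚ) * (f.map (Int.castRingHom ℚ)).discr)) :
    Function.Surjective (MulAction.toPermHom (absoluteGaloisGroup K) (Roots f)) :=
  MonoidHom.range_eq_top.1 (range_toPermHom_eq_top hgen hD hD3)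

/-- **`rbarExtendedAdequate`** (registered helper of `stub_finiteOverWeights`, UNCONDITIONAL): for a
generic quartic `f` with `disc f ∉ ℚ^{×2} ∪ (−3)ℚ^{×2}` and any basis `B` of the heart, the image of
the residual heart `r̄_f^B : Γ_K → GL₃(𝔽₃)` is adequate in the extended sense of GHT 2017 §1 =
Thorne 2017 Def. 2.20.  Proof: `rbar f B` is the matrix form `Units.map (toMatrixAlgEquiv B) ∘
heartRep 3 (Roots f) Γ_K` (by `rfl`), `#Roots f = 4`, and `Γ_K ↠ Sym(Roots f)`
(`toPermHom_surjective`); conclude by the Literature theorem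
`isExtendedAdequate_range_heartRep_toMatrix` (GHT Prop. 6.6 for the heart of four points over `𝔽₃`,
no classification of finite simple groups). -/
theorem rbarExtendedAdequate : ∀ (f : ℤ[X]) (B : Module.Basis (Fin 3) (ZMod 3) (Heart 3 (Roots f))), Generic f → ¬ IsSquare (f.map (Int.castRingHom ℚ)).discr → ¬ IsSquare ((-3 : ℚ) * (f.map (Int.castRingHom ℚ)).discr) → Subgroup.IsExtendedAdequate (rbar f B).range := by
  intro f B hgen hD hD3
  have hcard : Fintype.card (Roots f) = 4 := FreeSeedSmoothRt.card_roots hgen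
  exact isExtendedAdequate_range_heartRep_toMatrix hcard (toPermHom_surjective hgen hD hD3) B

end

end Summit.Langlands.Langlands.Cruxes.MuOrdinaryFamilyRT.ThorneMinimalLift
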